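import Mathlib

/-!
# Route ConvexRankGates, crux `LinAlgGateBlind` (stmt-PneNP-10681): skew matrices supported on a graph without a perfect matching are singular

Support lemmas for `TUTTE_d ⊆ GRANK_d` (`…TutteIsGRank`: the Tutte door is a GRANK door — Tutte 1947 in gate form). The hard
half of Tutte's determinant criterion, for an ARBITRARY skew-symmetric matrix `M` over a field of characteristic `≠ 2` whose
off-diagonal support lies in the edge set of a finite graph `H`:

* `det_eq_zero_of_transpose_eq_neg_of_odd` — an odd skew-symmetric matrix is singular (`det Mᵀ = det (-M)`);
* `det_eq_zero_of_forall_not_isPerfectMatching` — if `H` has no perfect matching then `det M = 0`: by Tutte's theorem (Mathlib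
  `exists_isTutteViolator`) some `u` leaves more than `#u` odd components in `H - u`; each odd diagonal block of `M` is odd
  skew-symmetric, hence has a kernel vector; a non-trivial combination of these (more unknowns than the `#u` equations of the
  rows in `u`) is a kernel vector of `M`, the blocks being decoupled off `u`.

Sources: W. T. Tutte, The factorization of linear graphs (1947); L. Lovász – M. D. Plummer, Matching Theory (1986) §8.2.
No new definitions. [folklore]
-/

-- `Summit.PneNP.PneNP.…` duplicates `PneNP` BY DESIGN (single-problem summit).
set_option linter.dupNamespace false

namespace Summit.PneNP.PneNP.Theorems

open SimpleGraph Matrix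

/-- An odd skew-symmetric matrix over a field of characteristic `≠ 2` is singular: `det M = det Mᵀ = det (-M) = -det M`.
[folklore] -/
theorem det_eq_zero_of_transpose_eq_neg_of_odd {K ι : Type*} [Field K] [Fintype ι] [DecidableEq ι] (h2 : (2 : K) ≠ 0)
    (M : Matrix ι ι K) (hM : Mᵀ = -M) (hodd : Odd (Fintype.card ι)) : M.det = 0 := by
  have h := det_transpose M
  rw [hM, det_neg, hodd.neg_one_pow, neg_one_mul] at h
  have h' : 2 * M.det = 0 := by
    rw [two_mul]
    nth_rw 1 [← h]
    exact neg_add_cancel _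
  exact (mul_eq_zero.1 h').resolve_left h2

/-- **A skew-symmetric matrix supported on a graph without a perfect matching is singular** (the hard half of Tutte's
determinant criterion, for arbitrary entries). Let `M` be a skew-symmetric `V × V` matrix over a field with `2 ≠ 0` such that
`M a b ≠ 0 → H.Adj a b`. If `H` has no perfect matching then `det M = 0`. [folklore] -/
theorem det_eq_zero_of_forall_not_isPerfectMatching {K V : Type*} [Field K] [Fintype V] [DecidableEq V] (h2 : (2 : K) ≠ 0)
    (H : SimpleGraph V) (M : Matrix V V K) (hM : Mᵀ = -M) (hsupp : ∀ a b, M a b ≠ 0 → H.Adj a b)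
    (hH : ∀ N : H.Subgraph, ¬ N.IsPerfectMatching) : M.det = 0 := by
  classical
  have hMba : ∀ a b, M b a = -M a b := fun a b => by
    have := congrFun (congrFun hM a) b
    simpa [Matrix.transpose_apply] using this
  rcases Nat.even_or_odd (Fintype.card V) with heven | hodd
  swap
  · exact det_eq_zero_of_transpose_eq_neg_of_odd h2 M hM hodd
  -- a Tutte violator `u` and the odd components of `H - u`
  obtain ⟨u, hu⟩ := exists_isTutteViolator hH (by rwa [Nat.card_eq_fintype_card])
  set G₀ := ((⊤ : H.Subgraph).deleteVerts u).coe with hG₀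
  have hmem : ∀ v, v ∉ u → v ∈ ((⊤ : H.Subgraph).deleteVerts u).verts := fun v hv => by simp [hv]
  have hnot : ∀ v : ((⊤ : H.Subgraph).deleteVerts u).verts, (v : V) ∉ u := fun v => by
    simpa only [Subgraph.deleteVerts_verts, Subgraph.verts_top, Set.mem_sdiff, Set.mem_univ, true_and] using v.2
  -- the embedding of a component's support into `V` and the diagonal block of `M` on it
  set emb : ∀ c : G₀.oddComponents, c.val.supp → V := fun c p => (p.1 : V) with hemb
  have hemb_inj : ∀ c : G₀.oddComponents, Function.Injective (emb c) := fun c p q h =>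
    Subtype.ext (Subtype.ext h)
  set B : ∀ c : G₀.oddComponents, Matrix c.val.supp c.val.supp K := fun c p q => M (emb c p) (emb c q) with hB
  -- each odd block is odd skew-symmetric, hence has a kernel vector
  have hker : ∀ c : G₀.oddComponents, ∃ y : c.val.supp → K, y ≠ 0 ∧ B c *ᵥ y = 0 := by
    intro c
    have hodd : Odd (Fintype.card c.val.supp) := by
      have hc : Odd c.val.supp.ncard := c.prop
      rwa [← Nat.card_coe_set_eq, Nat.card_eq_fintype_card] at hc
    have hskew : (B c)ᵀ = -B c := by
      ext p q
      simp only [hB, Matrix.transpose_apply, Matrix.neg_apply]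
      exact hMba _ _
    exact Matrix.exists_mulVec_eq_zero_iff.2 (det_eq_zero_of_transpose_eq_neg_of_odd h2 (B c) hskew hodd)
  choose y hy0 hy using hker
  -- extension by zero of the block kernel vectors
  set ext : G₀.oddComponents → V → K := fun c b => ∑ p : c.val.supp, if emb c p = b then y c p else 0 with hext
  have hext_emb : ∀ (c : G₀.oddComponents) (p : c.val.supp), ext c (emb c p) = y c p := by
    intro c p
    simp only [hext]
    rw [Finset.sum_eq_single p]
    · simp
    · intro q _ hqp
      rw [if_neg]
      exact fun h => hqp (hemb_inj c h)
    · simp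
  have hext_off : ∀ (c : G₀.oddComponents) (b : V), (∀ p : c.val.supp, emb c p ≠ b) → ext c b = 0 := by
    intro c b hb
    simp only [hext]
    exact Finset.sum_eq_zero fun p _ => if_neg (hb p)
  -- the rows of `M · ext c`: zero off `u`
  have hrow : ∀ (c : G₀.oddComponents) (a : V), (M *ᵥ ext c) a = ∑ p : c.val.supp, M a (emb c p) * y c p := by
    intro c a
    simp only [Matrix.mulVec, dotProduct, hext, Finset.mul_sum]
    rw [Finset.sum_comm]
    refine Finset.sum_congr rfl fun p _ => ?_
    rw [Finset.sum_eq_single (emb c p)]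
    · simp
    · intro b _ hb
      rw [if_neg (Ne.symm hb), mul_zero]
    · simp
  have hrow_off : ∀ (c : G₀.oddComponents) (a : V), a ∉ u → (M *ᵥ ext c) a = 0 := by
    intro c a hau
    rw [hrow]
    by_cases hac : (⟨a, hmem a hau⟩ : ((⊤ : H.Subgraph).deleteVerts u).verts) ∈ c.val.supp
    · -- inside the block: the block kernel equation
      have h := congrFun (hy c) ⟨⟨a, hmem a hau⟩, hac⟩
      simpa [Matrix.mulVec, dotProduct, hB, hemb] using h
    · -- outside the block: no edge of `H` from `a` into the block off `u`
      refine Finset.sum_eq_zero fun p _ => ?_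
      have hzero : M a (emb c p) = 0 := by
        by_contra hne
        have hadj : H.Adj a (emb c p) := hsupp _ _ hne
        have hG : G₀.Adj ⟨a, hmem a hau⟩ p.1 := by
          simp only [hG₀, Subgraph.coe_adj, Subgraph.deleteVerts_adj, Subgraph.verts_top, Set.mem_univ, true_and,
            Subgraph.top_adj]
          exact ⟨hau, hnot p.1, hadj⟩
        apply hac
        rw [ConnectedComponent.mem_supp_iff, ConnectedComponent.connectedComponentMk_eq_of_adj hG]
        exact (ConnectedComponent.mem_supp_iff _ _).1 p.2
      rw [hzero, zero_mul]
  -- more odd components than vertices in `u`: a non-trivial combination kills the rows in `u`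
  haveI : Fintype G₀.oddComponents := Fintype.ofFinite _
  set T : Matrix u G₀.oddComponents K := fun a c => (M *ᵥ ext c) a with hT
  have hlt : Module.finrank K (u → K) < Module.finrank K (G₀.oddComponents → K) := by
    rw [Module.finrank_fintype_fun_eq_card, Module.finrank_fintype_fun_eq_card]
    have h := hu
    rw [IsTutteViolator, ← Nat.card_coe_set_eq, ← Nat.card_coe_set_eq, Nat.card_eq_fintype_card,
      Nat.card_eq_fintype_card] at h
    exact h
  obtain ⟨lam, hlamker, hlam0⟩ := Submodule.exists_mem_ne_zero_of_ne_bot (LinearMap.ker_ne_bot_of_finrank_lt hlt (f := T.mulVecLin))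
  rw [LinearMap.mem_ker, Matrix.mulVecLin_apply] at hlamker
  set z : V → K := ∑ c : G₀.oddComponents, lam c • ext c with hz
  have hMz : M *ᵥ z = 0 := by
    ext a
    have hsum : (M *ᵥ z) a = ∑ c : G₀.oddComponents, lam c * (M *ᵥ ext c) a := by
      simp only [hz, Matrix.mulVec_sum, Matrix.mulVec_smul, Finset.sum_apply, Pi.smul_apply, smul_eq_mul]
    rw [hsum, Pi.zero_apply]
    by_cases hau : a ∈ u
    · have h := congrFun hlamker ⟨a, hau⟩
      simp only [Matrix.mulVec, dotProduct, hT, Pi.zero_apply] at h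
      rw [← h]
      exact Finset.sum_congr rfl fun c _ => mul_comm _ _
    · exact Finset.sum_eq_zero fun c _ => by rw [hrow_off c a hau, mul_zero]
  have hz0 : z ≠ 0 := by
    obtain ⟨c₀, hc₀⟩ := Function.ne_iff.1 hlam0
    obtain ⟨p₀, hp₀⟩ := Function.ne_iff.1 (hy0 c₀)
    intro hz0'
    have h := congrFun hz0' (emb c₀ p₀)
    simp only [hz, Finset.sum_apply, Pi.smul_apply, smul_eq_mul, Pi.zero_apply] at h
    rw [Finset.sum_eq_single c₀] at h
    · rw [hext_emb] at h
      exact (mul_ne_zero hc₀ hp₀) h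
    · intro c _ hc
      rw [hext_off, mul_zero]
      intro p hp
      -- a common vertex forces `c = c₀`
      apply hc
      have hpv : p.1 = p₀.1 := Subtype.ext hp
      exact Subtype.ext (ConnectedComponent.eq_of_common_vertex (hpv ▸ p.2) p₀.2)
    · simp
  exact Matrix.exists_mulVec_eq_zero_iff.1 ⟨z, hz0, hMz⟩

/-- **Registered form** of `det_eq_zero_of_forall_not_isPerfectMatching` (at `K V : Type`). [folklore] -/
theorem det_eq_zero_of_noPerfectMatching : ∀ {K V : Type} [Field K] [Fintype V] [DecidableEq V], (2 : K) ≠ 0 →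
    ∀ (H : SimpleGraph V) (M : Matrix V V K), Matrix.transpose M = -M → (∀ a b, M a b ≠ 0 → H.Adj a b) →
    (∀ N : H.Subgraph, ¬ N.IsPerfectMatching) → M.det = 0 := by
  intro K V _ _ _ h2 H M
  exact det_eq_zero_of_forall_not_isPerfectMatching h2 H M

/-- A singular square matrix has all its full-size row/column selections singular (repeated rows or columns, or a permutation
of the matrix). [folklore] -/
theorem det_submatrix_eq_zero_of_det_eq_zero {K : Type*} [CommRing K] {d : ℕ} (M : Matrix (Fin d) (Fin d) K)
    (h : M.det = 0) (r c : Fin d → Fin d) : (M.submatrix r c).det = 0 := by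
  classical
  by_cases hr : Function.Injective r
  swap
  · obtain ⟨i, j, hij, hne⟩ : ∃ i j, r i = r j ∧ i ≠ j := by
      simpa [Function.Injective, not_forall] using hr
    exact Matrix.det_zero_of_row_eq hne (funext fun k => by simp [Matrix.submatrix_apply, hij])
  by_cases hc : Function.Injective c
  swap
  · obtain ⟨i, j, hij, hne⟩ : ∃ i j, c i = c j ∧ i ≠ j := by
      simpa [Function.Injective, not_forall] using hc
    exact Matrix.det_zero_of_column_eq hne fun k => by simp [Matrix.submatrix_apply, hij]
  set ρ : Fin d ≃ Fin d := Equiv.ofBijective r (Finite.injective_iff_bijective.1 hr) with hρ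
  set γ : Fin d ≃ Fin d := Equiv.ofBijective c (Finite.injective_iff_bijective.1 hc) with hγ
  have hsub : M.submatrix r c = (M.submatrix ρ ρ).submatrix id (γ.trans ρ.symm) := by
    ext i j
    simp [Matrix.submatrix_apply, hρ, hγ, Equiv.ofBijective_apply_symm_apply]
  rw [hsub, Matrix.det_permute', Matrix.det_submatrix_equiv_self, h, mul_zero]

end Summit.PneNP.PneNP.Theorems
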